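import Summits.QuantumFields.BalabanUV.T4Continuum.Support.SliceComplementFlatGap
import Summits.QuantumFields.BalabanUV.T4Continuum.Support.DivControlOfSliceClose

/-!
# T⁴ programme, spine node NE2 (U1a), lane P2 — THE SLICE SUBSPACES OF TWO NEARBY FRAME FIELDS ARE CLOSE, AND (GF3) TRANSFERS BETWEEN THEM:
# for unitary frame fields `T₁, T₂` with `‖T₁(x) − T₂(x)‖ ≤ τ` (pointwise, ANY gauge — only the RELATIVE distance enters) the covariant slice subspaces
# `S_R(ker Q_{T₁})`, `S_R(ker Q_{T₂})` of the SAME bond field `R` are one-sidedly `4τ·C₁`-close, and the coercivity binder (GF3) for `projG R (ker Q_{T₁})`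
# implies (GF3) for `projG R (ker Q_{T₂})` with constants `(4C_D, 2C_D′)` — no flat object, no regular gauge, general finite-dimensional Hilbert `E` (model level)

NE2 formalisation swarm `b2b-balaban-t4-ne2-formalise-*`, leaf prover 04 GEN 6 (`prover-b2b-balaban-t4-ne2-formalise-leaf-04-g6-0`); journal CLAIMS.log
«SLICE-FRAME-GAP» (follows «(GF3) WITH BACKGROUND FOR COVARIANT FRAMES», l.18848 ∕ memo `t4/T4-EST-NE2-P2-GF3COV.md` §4 row 3).  On top of this seat's
`SliceComplementFlatGap.{orth_ker_of_mem_orthogonal, nsqv_lapR_le_of_orth, norm_toLp_le_of_nsqv_le, sqrt_nsqv_eq_norm}` (p231185), leaf-03-g6's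
`CovariantSliceComplement.{eq_transport_blockConst_of_orth_ker, norm_eq_of_orth_ker, ipv_transport_blockConst}` ∕ `CovariantBlockReversePoincare.{revPC, re_ipv_le,
ipv_negLapv_comm, sum_nsqv_Dirv_eq_re, mul_le_of_sqrt_chain}`, leaf-09-g4's colour block Poincaré `VariationalColourPoincareLocal.nsqv_le_colour_poincare_of_blockOf`,
`DivControlOfSliceClose.norm_starProjection_le_of_oneSided'`
— BY NAME.

WHY.  The vector END at Bałaban's taxi data (parts 6–8 of «V-COL-TAXI-END») gauge-fixes with the frames `taxiTv (Rlev k)` of the level-`k` block, while the (ONE-min)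
supplier (leaf-01-g8 `hONEm_centred`, p233079) works in the COMPOSITE fibre `ker (Q_T ∘ Q_{T′})` — a single block average with the composite frames `T(block)∘T′`;
the two frame fields differ by a holonomy, pointwise `O((d−1)·n²p)` in ANY gauge, never by a small RELATIVE BOUND on `ker`.  The duality of `SliceComplementFlatGap`
handles exactly this: on `S_R(ker Q_{T₂})ᗮ` one has `div_R D_R s = T₂(x)⋆c(block x)`, which is `τ‖div_R D_R s‖`-close to `T₁(x)⋆c(block x) ⊥ ker Q_{T₁}`.

THE STATEMENTS ([folklore]; unitary `R`, `T₁`, `T₂`; in-block mismatch classes `‖R(x,μ)T_i(x+e_μ)⋆T_i(x) − 1‖ ≤ w_i`; `C₁ = revPC d n w₂`).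
 * §1 **`norm_le_of_ker_frame`**: on `ker Q_{T₁}` (class `2d(nw₁)² ≤ ½`), `‖toLp k‖ ≤ 4n²·‖toLp (div_R D_R k)‖` (colour block Poincaré + duality).
 * §2 `nsqv_sub_frame_le_of_orth` (`‖T₂⋆c(block ·) − T₁⋆c(block ·)‖² ≤ τ²·‖div_R D_R s‖²`), **`sliceFrames_close`**:
   `∀ y ∈ S_R(ker Q_{T₁}), ‖y − Π_{S_R(ker Q_{T₂})} y‖ ≤ (4·τ·revPC d n w₂)·‖y‖` — n-UNIFORM in the classes `nw_i`, and only `‖T₁ − T₂‖ ≤ τ` enters.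
 * §3 **`projG_le_of_sliceClose`** (`projG R K₁ W ≤ 2·projG R K₂ W + 2δ²·divSq_R W` from the one-sided closeness `S_R(K₁) → S_R(K₂)` — the letter a
   fine-level supplier needs to move its gauge functional between two fixings), **`divControl_transfer`** (any `R`, any submodules `K₁, K₂`, any `Q`): (GF3) for `(R, K₁, Q)` with `(C_D, C_D′)` and the one-sided closeness `S_R(K₁) → S_R(K₂)`
   with constant `δ`, `4C_D·δ² ≤ 1` ⟹ (GF3) for `(R, K₂, Q)` with `(4C_D + 2, 2C_D′)`; **`divControl_frames`** = §3 ∘ §2.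
NOT HERE: the identification of the composite-fibre frames with a single frame field on the composite block (the `sites` bookkeeping of the tower files); any
statement about Bałaban's taxi data (the consumer plugs `T₁ := taxiTv`, `T₂ :=` composite frames).

HONEST FRAMING (T4-DAG p. 1).  Rung (B)+1 only — NOT infinite volume, NOT a mass gap, NOT Clay.  NE2 NOT IN PRINT, NOT proved here.  MODEL LEVEL (c5): `R`, `T₁`,
`T₂`, `Q` DATA; OURS, elementary ([folklore]); nothing printed is a hypothesis; no `def`, no `def … : Prop`, no `sorry`; axioms standard; the constant carries
`revPC = 4d·36^d(1+nw)²` (quantitatively void thresholds, memo GF3COV §3).  V-END with background ∕ NE2 NOT proved; NE3 OPEN; spine PROVED 0∕9.  HONEST DEPENDENCY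
(cell, verbatim): continuum YM on T⁴ ⇐ BetaPertH ∧ nine spine estimates (0/9 proved); BetaPertH ⇐ (D1) ∧ (D4) ∧ CAP+tail; G-an2-4 gates asym, D1 and NE2/3/4.
-/

noncomputable section

namespace Summit.QuantumFields.BalabanUV.T4Continuum.SliceFrameGap

open Finset WithLp
open scoped InnerProductSpace ComplexConjugate BigOperators
open Literature.MathematicalPhysics.QuantumFieldTheory.Balaban1983to89.B5Prop11Plancherel (Tor fine unitVec)
open Literature.MathematicalPhysics.QuantumFieldTheory.Balaban1983to89.B5Blocks16 (blockOf)
open Summit.QuantumFields.BalabanUV.T4Continuum.VariationalColourFederbush (cDv Qcv dirUv)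
open Summit.QuantumFields.BalabanUV.T4Continuum.VariationalColourBochner
  (Dirv negLapv nsqv nsqv_nonneg ipv ipv_self conj_ipv sum_nsqv_Dirv_eq)
open Summit.QuantumFields.BalabanUV.T4Continuum.VariationalVectorWeitzenbock (divV divSq divSq_nonneg)
open Summit.QuantumFields.BalabanUV.T4Continuum.VariationalVectorForm (curlSq ScV qWV curlSq_nonneg)
open Summit.QuantumFields.BalabanUV.T4Continuum.VectorBlockTrialForm (nsqV nsqV_nonneg)
open Summit.QuantumFields.BalabanUV.T4Continuum.VariationalVectorGaugeSlice
  (avgOp avgOp_apply lapOp lapOp_eq_negLapv sliceSub mem_sliceSub projG projG_nonneg norm_toLp_sq)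
open Summit.QuantumFields.BalabanUV.T4Continuum.VariationalColourPoincareLocal (nsqv_le_colour_poincare_of_blockOf)
open Summit.QuantumFields.BalabanUV.T4Continuum.CovariantBlockReversePoincare (revPC revPC_nonneg re_ipv_le ipv_negLapv_comm sum_nsqv_Dirv_eq_re mul_le_of_sqrt_chain)
open Summit.QuantumFields.BalabanUV.T4Continuum.CovariantSliceComplement
  (eq_transport_blockConst_of_orth_ker norm_eq_of_orth_ker ipv_transport_blockConst)
open Summit.QuantumFields.BalabanUV.T4Continuum.DivControlOfSliceClose (norm_starProjection_le_of_oneSided')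
open Summit.QuantumFields.BalabanUV.T4Continuum.SliceComplementFlatGap (orth_ker_of_mem_orthogonal nsqv_lapR_le_of_orth norm_toLp_le_of_nsqv_le sqrt_nsqv_eq_norm)

variable {d : ℕ} {E : Type*} [NormedAddCommGroup E] [InnerProductSpace ℂ E] [CompleteSpace E] [FiniteDimensional ℂ E]
variable (n : ℕ) [NeZero n] (M : Fin d → ℕ) [hM : ∀ μ, NeZero (M μ)]

/-! ## §1 Poincaré-duality on the kernel of a transported block average -/

/-- **on `ker Q_{T₁}`: `‖toLp k‖ ≤ 4n²·‖toLp (div_R D_R k)‖`** (unitary `T₁`, mismatch `w₁` with `2d(nw₁)² ≤ ½`): colour block Poincaré `‖k‖² ≤ 4n²Σ‖D_R k‖²` and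
`Σ‖D_R k‖² = Re⟪k, div_R D_R k⟫ ≤ ‖k‖·‖div_R D_R k‖`. [folklore] -/
theorem norm_le_of_ker_frame {R : Tor (fine n M) → Fin d → (E →L[ℂ] E)} {T₁ : Tor (fine n M) → (E →L[ℂ] E)} (hT₁ : ∀ x, T₁ x ∈ unitary (E →L[ℂ] E))
    {w₁ : ℝ} (hw₁ : ∀ (x : Tor (fine n M)) (μ : Fin d), blockOf n M (x + unitVec (fine n M) μ) = blockOf n M x →
      ‖R x μ * star (T₁ (x + unitVec (fine n M) μ)) * T₁ x - 1‖ ≤ w₁)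
    (hsmall₁ : 2 * (d : ℝ) * ((n : ℝ) * w₁) ^ 2 ≤ 1 / 2) {k : Tor (fine n M) → E} (hk : Qcv n M T₁ k = 0) :
    ‖toLp 2 k‖ ≤ 4 * (n : ℝ) ^ 2 * ‖toLp 2 (negLapv (fine n M) R k)‖ := by
  set A := ∑ μ, nsqv (fine n M) (Dirv (fine n M) R μ k) with hA
  set U := nsqv (fine n M) k with hU
  set Lk := nsqv (fine n M) (negLapv (fine n M) R k) with hL
  have hA0 : 0 ≤ A := sum_nonneg fun μ _ => nsqv_nonneg _ _
  have hU0 : 0 ≤ U := nsqv_nonneg _ _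
  have hL0 : 0 ≤ Lk := nsqv_nonneg _ _
  -- colour block Poincaré on `ker Q_{T₁}`
  have hP : U ≤ 4 * (n : ℝ) ^ 2 * A := by
    have h := nsqv_le_colour_poincare_of_blockOf n M (R := R) hT₁ hw₁ hsmall₁ k
    rw [hk] at h
    simp only [Pi.zero_apply, norm_zero, ne_eq, OfNat.ofNat_ne_zero, not_false_eq_true, zero_pow, sum_const_zero, mul_zero, zero_add] at h
    rw [hA, sum_nsqv_Dirv_eq]; exact h
  -- duality: `A = Re⟪k, div_R D_R k⟫ ≤ √U √Lk`
  have h1 : A ≤ Real.sqrt U * Real.sqrt Lk := by rw [hA, sum_nsqv_Dirv_eq_re]; exact re_ipv_le (fine n M) k _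
  have h2 : 1 * A ≤ 4 * (n : ℝ) ^ 2 * Lk := mul_le_of_sqrt_chain hA0 hU0 hL0 (by positivity) zero_le_one h1 (by linarith [hP])
  have h3 : U ≤ (4 * (n : ℝ) ^ 2) ^ 2 * Lk := by nlinarith [hP, h2]
  exact norm_toLp_le_of_nsqv_le (fine n M) (by positivity) h3

/-! ## §2 The slice subspaces of two nearby frame fields are one-sidedly close -/

omit [FiniteDimensional ℂ E] in
/-- on `S_R(ker Q_{T₂})ᗮ`: `div_R D_R s = T₂⋆c(block ·)` is `τ`-close to `T₁⋆c(block ·)`: `nsqv (T₂⋆c∘block − T₁⋆c∘block) ≤ τ²·nsqv (div_R D_R s)` for `‖T₁ − T₂‖ ≤ τ`. [folklore] -/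
theorem nsqv_sub_frame_le_of_orth {T₁ T₂ : Tor (fine n M) → (E →L[ℂ] E)} (hT₂ : ∀ x, T₂ x ∈ unitary (E →L[ℂ] E)) {τ : ℝ} (hτ : ∀ x, ‖T₁ x - T₂ x‖ ≤ τ)
    (R : Tor (fine n M) → Fin d → (E →L[ℂ] E)) {s : Tor (fine n M) → E} (hs : toLp 2 s ∈ (sliceSub (fine n M) R (LinearMap.ker (avgOp n M T₂)))ᗮ) :
    nsqv (fine n M) ((fun x => star (T₂ x) (Qcv n M T₂ (negLapv (fine n M) R s) (blockOf n M x)))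
        - fun x => star (T₁ x) (Qcv n M T₂ (negLapv (fine n M) R s) (blockOf n M x)))
      ≤ τ ^ 2 * nsqv (fine n M) (negLapv (fine n M) R s) := by
  have horth := orth_ker_of_mem_orthogonal n M R T₂ hs
  have hnorm := norm_eq_of_orth_ker n M hT₂ horth
  have hpt : ∀ x, ‖((fun x => star (T₂ x) (Qcv n M T₂ (negLapv (fine n M) R s) (blockOf n M x)))
      - fun x => star (T₁ x) (Qcv n M T₂ (negLapv (fine n M) R s) (blockOf n M x))) x‖ ^ 2 ≤ τ ^ 2 * ‖negLapv (fine n M) R s x‖ ^ 2 := by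
    intro x
    have e : ((fun x => star (T₂ x) (Qcv n M T₂ (negLapv (fine n M) R s) (blockOf n M x)))
        - fun x => star (T₁ x) (Qcv n M T₂ (negLapv (fine n M) R s) (blockOf n M x))) x
        = (star (T₂ x) - star (T₁ x)) (Qcv n M T₂ (negLapv (fine n M) R s) (blockOf n M x)) := by
      rw [Pi.sub_apply, sub_apply]
    have hst : ‖star (T₂ x) - star (T₁ x)‖ ≤ τ := by
      rw [← star_sub, norm_star, norm_sub_rev]; exact hτ x
    have h1 : ‖((fun x => star (T₂ x) (Qcv n M T₂ (negLapv (fine n M) R s) (blockOf n M x)))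
        - fun x => star (T₁ x) (Qcv n M T₂ (negLapv (fine n M) R s) (blockOf n M x))) x‖ ≤ τ * ‖negLapv (fine n M) R s x‖ := by
      rw [e, hnorm x]
      exact (ContinuousLinearMap.le_opNorm _ _).trans (mul_le_mul_of_nonneg_right hst (norm_nonneg _))
    have h0 := norm_nonneg (((fun x => star (T₂ x) (Qcv n M T₂ (negLapv (fine n M) R s) (blockOf n M x)))
        - fun x => star (T₁ x) (Qcv n M T₂ (negLapv (fine n M) R s) (blockOf n M x))) x)
    have h3 := mul_le_mul h1 h1 h0 (h0.trans h1)
    nlinarith [h3]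
  unfold nsqv
  rw [mul_sum]
  exact sum_le_sum fun x _ => hpt x

/-- **THE SLICE SUBSPACES OF TWO NEARBY FRAME FIELDS ARE ONE-SIDEDLY CLOSE**: unitary `R`, unitary frames `T₁`, `T₂` with `‖T₁(x) − T₂(x)‖ ≤ τ`, mismatch classes
`w₁` (with `2d(nw₁)² ≤ ½`) and `w₂`.  Then `∀ y ∈ S_R(ker Q_{T₁}), ‖y − Π_{S_R(ker Q_{T₂})} y‖ ≤ (4·τ·revPC d n w₂)·‖y‖` — only the RELATIVE distance of the frames
enters (any gauge), UNIFORM in n in the classes `nw_i`. [folklore] -/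
theorem sliceFrames_close {R : Tor (fine n M) → Fin d → (E →L[ℂ] E)} (hU : ∀ x μ, R x μ ∈ unitary (E →L[ℂ] E))
    {T₁ T₂ : Tor (fine n M) → (E →L[ℂ] E)} (hT₁ : ∀ x, T₁ x ∈ unitary (E →L[ℂ] E)) (hT₂ : ∀ x, T₂ x ∈ unitary (E →L[ℂ] E))
    {τ : ℝ} (hτ : ∀ x, ‖T₁ x - T₂ x‖ ≤ τ) {w₁ w₂ : ℝ}
    (hw₁ : ∀ (x : Tor (fine n M)) (μ : Fin d), blockOf n M (x + unitVec (fine n M) μ) = blockOf n M x →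
      ‖R x μ * star (T₁ (x + unitVec (fine n M) μ)) * T₁ x - 1‖ ≤ w₁)
    (hsmall₁ : 2 * (d : ℝ) * ((n : ℝ) * w₁) ^ 2 ≤ 1 / 2) (hw₂0 : 0 ≤ w₂)
    (hw₂ : ∀ (x : Tor (fine n M)) (μ : Fin d), blockOf n M (x + unitVec (fine n M) μ) = blockOf n M x →
      ‖R x μ * star (T₂ (x + unitVec (fine n M) μ)) * T₂ x - 1‖ ≤ w₂) :
    ∀ y ∈ sliceSub (fine n M) R (LinearMap.ker (avgOp n M T₁)),
      ‖y - (sliceSub (fine n M) R (LinearMap.ker (avgOp n M T₂))).starProjection y‖ ≤ (4 * τ * revPC d n w₂) * ‖y‖ := by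
  intro y hy
  have hn : (0 : ℝ) < n := by exact_mod_cast Nat.pos_of_ne_zero (NeZero.ne n)
  have hτ0 : 0 ≤ τ := (norm_nonneg _).trans (hτ 0)
  have hC := revPC_nonneg (d := d) n w₂
  -- `y = toLp (div_R D_R k)` with `Q_{T₁} k = 0`
  rw [mem_sliceSub, Submodule.mem_map] at hy
  obtain ⟨k, hkK, hky⟩ := hy
  have hk : Qcv n M T₁ k = 0 := by
    have := LinearMap.mem_ker.mp hkK
    rwa [avgOp_apply] at this
  have ey : y = toLp 2 (negLapv (fine n M) R k) := by rw [← lapOp_eq_negLapv, hky, toLp_ofLp]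
  -- the residual `q = y − Π₂ y ∈ S_R(ker Q_{T₂})ᗮ`
  set q := y - (sliceSub (fine n M) R (LinearMap.ker (avgOp n M T₂))).starProjection y with hq
  have hq_orth : q ∈ (sliceSub (fine n M) R (LinearMap.ker (avgOp n M T₂)))ᗮ := Submodule.sub_starProjection_mem_orthogonal y
  have hs : toLp 2 (ofLp q) ∈ (sliceSub (fine n M) R (LinearMap.ker (avgOp n M T₂)))ᗮ := by rw [toLp_ofLp]; exact hq_orth
  -- `‖q‖² = Re⟪q, y⟫ = Re ipv (div_R D_R q) k = Re ipv (f − g) k`, `g := T₁⋆c(block ·) ⊥ k`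
  have h1 : ‖q‖ ^ 2 = (⟪q, y⟫_ℂ).re := by
    have e : ⟪q, q⟫_ℂ = ⟪q, y⟫_ℂ := by
      rw [hq, inner_sub_right, Submodule.inner_left_of_mem_orthogonal (Submodule.starProjection_apply_mem _ y) hq_orth, sub_zero]
    rw [norm_sq_eq_re_inner (𝕜 := ℂ), e]; rfl
  have horth := orth_ker_of_mem_orthogonal n M R T₂ hs
  have hform := eq_transport_blockConst_of_orth_ker n M hT₂ horth
  have epair : (⟪q, y⟫_ℂ).re = (ipv (fine n M) ((fun x => star (T₂ x) (Qcv n M T₂ (negLapv (fine n M) R (ofLp q)) (blockOf n M x)))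
        - fun x => star (T₁ x) (Qcv n M T₂ (negLapv (fine n M) R (ofLp q)) (blockOf n M x))) k).re := by
    have e1 : ⟪q, y⟫_ℂ = ipv (fine n M) (ofLp q) (negLapv (fine n M) R k) := by rw [ey]; rfl
    have e2 := ipv_negLapv_comm (fine n M) R (ofLp q) k
    have e3 : ipv (fine n M) (negLapv (fine n M) R (ofLp q)) k
        = ipv (fine n M) (fun x => star (T₂ x) (Qcv n M T₂ (negLapv (fine n M) R (ofLp q)) (blockOf n M x))) k := by
      conv_lhs => rw [hform]
    have e4 : ipv (fine n M) (fun x => star (T₁ x) (Qcv n M T₂ (negLapv (fine n M) R (ofLp q)) (blockOf n M x))) k = 0 := by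
      rw [← conj_ipv, ipv_transport_blockConst, hk]
      simp
    have e5 : ipv (fine n M) ((fun x => star (T₂ x) (Qcv n M T₂ (negLapv (fine n M) R (ofLp q)) (blockOf n M x)))
          - fun x => star (T₁ x) (Qcv n M T₂ (negLapv (fine n M) R (ofLp q)) (blockOf n M x))) k
        = ipv (fine n M) (fun x => star (T₂ x) (Qcv n M T₂ (negLapv (fine n M) R (ofLp q)) (blockOf n M x))) k
          - ipv (fine n M) (fun x => star (T₁ x) (Qcv n M T₂ (negLapv (fine n M) R (ofLp q)) (blockOf n M x))) k := by
      unfold ipv; rw [← sum_sub_distrib]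
      exact sum_congr rfl fun x _ => by rw [← inner_sub_left, Pi.sub_apply]
    rw [e1, e2, e3, e5, e4, sub_zero]
  -- Cauchy–Schwarz and the three size bounds
  have hdiff : ‖toLp 2 ((fun x => star (T₂ x) (Qcv n M T₂ (negLapv (fine n M) R (ofLp q)) (blockOf n M x)))
        - fun x => star (T₁ x) (Qcv n M T₂ (negLapv (fine n M) R (ofLp q)) (blockOf n M x)))‖
      ≤ τ * ‖toLp 2 (negLapv (fine n M) R (ofLp q))‖ :=
    norm_toLp_le_of_nsqv_le (fine n M) hτ0 (nsqv_sub_frame_le_of_orth n M hT₂ hτ R hs)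
  have hlap : ‖toLp 2 (negLapv (fine n M) R (ofLp q))‖ ≤ revPC d n w₂ / (n : ℝ) ^ 2 * ‖q‖ := by
    have h := nsqv_lapR_le_of_orth n M hT₂ hU hw₂0 hw₂ hs
    have h' : ‖toLp 2 (negLapv (fine n M) R (ofLp q))‖ ≤ revPC d n w₂ / (n : ℝ) ^ 2 * ‖toLp 2 (ofLp q)‖ := by
      refine norm_toLp_le_of_nsqv_le (fine n M) (by positivity) ?_
      rw [div_pow, ← pow_mul, show 2 * 2 = 4 by norm_num, div_mul_eq_mul_div, le_div_iff₀ (by positivity), mul_comm]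
      exact h
    rwa [toLp_ofLp] at h'
  have hkle : ‖toLp 2 k‖ ≤ 4 * (n : ℝ) ^ 2 * ‖y‖ := by
    have h := norm_le_of_ker_frame n M (R := R) hT₁ hw₁ hsmall₁ hk
    rwa [← ey] at h
  have hcs : (ipv (fine n M) ((fun x => star (T₂ x) (Qcv n M T₂ (negLapv (fine n M) R (ofLp q)) (blockOf n M x)))
        - fun x => star (T₁ x) (Qcv n M T₂ (negLapv (fine n M) R (ofLp q)) (blockOf n M x))) k).re
      ≤ ‖toLp 2 ((fun x => star (T₂ x) (Qcv n M T₂ (negLapv (fine n M) R (ofLp q)) (blockOf n M x)))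
        - fun x => star (T₁ x) (Qcv n M T₂ (negLapv (fine n M) R (ofLp q)) (blockOf n M x)))‖ * ‖toLp 2 k‖ := by
    rw [← sqrt_nsqv_eq_norm, ← sqrt_nsqv_eq_norm]; exact re_ipv_le (fine n M) _ k
  have h2 : (⟪q, y⟫_ℂ).re ≤ (4 * τ * revPC d n w₂) * ‖q‖ * ‖y‖ := by
    rw [epair]
    calc _ ≤ _ := hcs
      _ ≤ (τ * (revPC d n w₂ / (n : ℝ) ^ 2 * ‖q‖)) * (4 * (n : ℝ) ^ 2 * ‖y‖) :=
          mul_le_mul (hdiff.trans (mul_le_mul_of_nonneg_left hlap hτ0)) hkle (norm_nonneg _) (by positivity)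
      _ = _ := by field_simp
  have h3 : ‖q‖ * ‖q‖ ≤ ((4 * τ * revPC d n w₂) * ‖y‖) * ‖q‖ := by rw [← sq, h1]; linarith [h2]
  rcases (norm_nonneg q).eq_or_lt with hq0 | hqpos
  · rw [← hq0]; positivity
  · exact le_of_mul_le_mul_right h3 hqpos

/-! ## §3 (GF3) transfers along a one-sided slice closeness with the SAME bond field and average -/

/-- **THE PROJECTED FUNCTIONALS OF TWO GAUGE FIXINGS COMPARE along a one-sided slice closeness** (any `R`, any submodules; lattice units):
`∀ y ∈ S_R(K₁), ‖y − Π_{S_R(K₂)} y‖ ≤ δ‖y‖` (`0 ≤ δ`) ⟹ `projG R K₁ W ≤ 2·projG R K₂ W + 2δ²·divSq_R W` for every `W`. [folklore] -/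
theorem projG_le_of_sliceClose (R : Tor (fine n M) → Fin d → (E →L[ℂ] E)) (K₁ K₂ : Submodule ℂ (Tor (fine n M) → E)) {δ : ℝ} (hδ0 : 0 ≤ δ)
    (hclose : ∀ y ∈ sliceSub (fine n M) R K₁, ‖y - (sliceSub (fine n M) R K₂).starProjection y‖ ≤ δ * ‖y‖) (W : Tor (fine n M) → Fin d → E) :
    projG (fine n M) R K₁ W ≤ 2 * projG (fine n M) R K₂ W + 2 * (δ ^ 2 * divSq (fine n M) R W) := by
  obtain ⟨b, hb⟩ : ∃ b : PiLp 2 (fun _ : Tor (fine n M) => E), b = toLp 2 (divV (fine n M) R W) := ⟨_, rfl⟩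
  have eD : divSq (fine n M) R W = ‖b‖ ^ 2 := by rw [hb, norm_toLp_sq]; rfl
  have eG₁ : projG (fine n M) R K₁ W = ‖(sliceSub (fine n M) R K₁).starProjection b‖ ^ 2 := by rw [hb]; rfl
  have eG₂ : projG (fine n M) R K₂ W = ‖(sliceSub (fine n M) R K₂).starProjection b‖ ^ 2 := by rw [hb]; rfl
  have f1 : ‖(sliceSub (fine n M) R K₁).starProjection b‖ ≤ ‖(sliceSub (fine n M) R K₂).starProjection b‖ + δ * ‖b‖ :=
    norm_starProjection_le_of_oneSided' _ _ hδ0 hclose b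
  rw [eG₁, eG₂, eD]
  have hsq := pow_le_pow_left₀ (norm_nonneg _) f1 2
  have hx : (‖(sliceSub (fine n M) R K₂).starProjection b‖ + δ * ‖b‖) ^ 2 ≤ 2 * ‖(sliceSub (fine n M) R K₂).starProjection b‖ ^ 2 + 2 * (δ * ‖b‖) ^ 2 := by
    nlinarith [sq_nonneg (‖(sliceSub (fine n M) R K₂).starProjection b‖ - δ * ‖b‖)]
  rw [mul_pow] at hx
  linarith [hsq, hx]


/-- **(GF3) TRANSFER**: if `n^{−d}(n²·divSq_R W) ≤ C_D·ScV n M R (projG R K₁) W + C_D′·nsqV (Q W)` for all `W` (`0 ≤ C_D`), every `y ∈ S_R(K₁)` has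
`‖y − Π_{S_R(K₂)} y‖ ≤ δ‖y‖` (`0 ≤ δ`, `0 ≤ C_D′`) and `4C_D·δ² ≤ 1`, then `n^{−d}(n²·divSq_R W) ≤ (4C_D + 2)·ScV n M R (projG R K₂) W + 2C_D′·nsqV (Q W)` for all `W`
— same `R`, same `Q`: only the gauge-fixing subspace changes, so no flat object and no Poincaré inequality is needed. [folklore] -/
theorem divControl_transfer (R : Tor (fine n M) → Fin d → (E →L[ℂ] E)) (K₁ K₂ : Submodule ℂ (Tor (fine n M) → E))
    {Q : (Tor (fine n M) → Fin d → E) → (Tor M → Fin d → E)} {CD CD' δ : ℝ} (hCD : 0 ≤ CD) (hCD' : 0 ≤ CD') (hδ0 : 0 ≤ δ)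
    (hGdiv₁ : ∀ W, ((n : ℝ) ^ d)⁻¹ * ((n : ℝ) ^ 2 * divSq (fine n M) R W) ≤ CD * ScV n M R (projG (fine n M) R K₁) W + CD' * nsqV M (Q W))
    (hclose : ∀ y ∈ sliceSub (fine n M) R K₁, ‖y - (sliceSub (fine n M) R K₂).starProjection y‖ ≤ δ * ‖y‖)
    (hsmall : 4 * CD * δ ^ 2 ≤ 1) (W : Tor (fine n M) → Fin d → E) :
    ((n : ℝ) ^ d)⁻¹ * ((n : ℝ) ^ 2 * divSq (fine n M) R W)
      ≤ (4 * CD + 2) * ScV n M R (projG (fine n M) R K₂) W + 2 * CD' * nsqV M (Q W) := by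
  have hn : (0 : ℝ) < n := by exact_mod_cast Nat.pos_of_ne_zero (NeZero.ne n)
  have hνn2 : (0 : ℝ) ≤ ((n : ℝ) ^ d)⁻¹ * (n : ℝ) ^ 2 := by positivity
  have g1 := projG_le_of_sliceClose n M R K₁ K₂ hδ0 hclose W
  -- physical units and the given (GF3)
  have k0 := hGdiv₁ W
  have hcurl0 : 0 ≤ ((n : ℝ) ^ d)⁻¹ * ((n : ℝ) ^ 2 * (curlSq (fine n M) R W / 2)) := by have := curlSq_nonneg (fine n M) R W; positivity
  have hP0 : 0 ≤ ((n : ℝ) ^ d)⁻¹ * ((n : ℝ) ^ 2 * divSq (fine n M) R W) := by have := divSq_nonneg (fine n M) R W; positivity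
  have hG20 : 0 ≤ ((n : ℝ) ^ d)⁻¹ * ((n : ℝ) ^ 2 * projG (fine n M) R K₂ W) := by have := projG_nonneg (fine n M) R K₂ W; positivity
  have eS₁ : ScV n M R (projG (fine n M) R K₁) W
      = ((n : ℝ) ^ d)⁻¹ * ((n : ℝ) ^ 2 * (curlSq (fine n M) R W / 2)) + ((n : ℝ) ^ d)⁻¹ * ((n : ℝ) ^ 2 * projG (fine n M) R K₁ W) := by unfold ScV; ring
  have eS₂ : ScV n M R (projG (fine n M) R K₂) W
      = ((n : ℝ) ^ d)⁻¹ * ((n : ℝ) ^ 2 * (curlSq (fine n M) R W / 2)) + ((n : ℝ) ^ d)⁻¹ * ((n : ℝ) ^ 2 * projG (fine n M) R K₂ W) := by unfold ScV; ring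
  have k1 : ((n : ℝ) ^ d)⁻¹ * ((n : ℝ) ^ 2 * projG (fine n M) R K₁ W)
      ≤ 2 * (((n : ℝ) ^ d)⁻¹ * ((n : ℝ) ^ 2 * projG (fine n M) R K₂ W)) + 2 * (δ ^ 2 * (((n : ℝ) ^ d)⁻¹ * ((n : ℝ) ^ 2 * divSq (fine n M) R W))) := by
    have h := mul_le_mul_of_nonneg_left g1 hνn2
    have e : ((n : ℝ) ^ d)⁻¹ * (n : ℝ) ^ 2 * (2 * projG (fine n M) R K₂ W + 2 * (δ ^ 2 * divSq (fine n M) R W))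
        = 2 * (((n : ℝ) ^ d)⁻¹ * ((n : ℝ) ^ 2 * projG (fine n M) R K₂ W)) + 2 * (δ ^ 2 * (((n : ℝ) ^ d)⁻¹ * ((n : ℝ) ^ 2 * divSq (fine n M) R W))) := by ring
    rw [e, show ((n : ℝ) ^ d)⁻¹ * (n : ℝ) ^ 2 * projG (fine n M) R K₁ W = ((n : ℝ) ^ d)⁻¹ * ((n : ℝ) ^ 2 * projG (fine n M) R K₁ W) by ring] at h
    exact h
  -- substitute: `D ≤ CD (cu + G₁) + CD' N ≤ CD (cu + 2G₂ + 2δ²D) + CD' N`, absorb `2CDδ²D ≤ D/2`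
  have hδD : CD * (2 * (δ ^ 2 * (((n : ℝ) ^ d)⁻¹ * ((n : ℝ) ^ 2 * divSq (fine n M) R W))))
      ≤ (1 / 2) * (((n : ℝ) ^ d)⁻¹ * ((n : ℝ) ^ 2 * divSq (fine n M) R W)) := by
    have := mul_le_mul_of_nonneg_right hsmall (show (0 : ℝ) ≤ (((n : ℝ) ^ d)⁻¹ * ((n : ℝ) ^ 2 * divSq (fine n M) R W)) / 2 by positivity)
    linarith
  rw [eS₁] at k0
  rw [eS₂]
  have t := mul_le_mul_of_nonneg_left k1 hCD
  have hN0 : 0 ≤ nsqV M (Q W) := nsqV_nonneg M _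
  have p1 := mul_nonneg hCD hcurl0
  have p2 := mul_nonneg hCD hG20
  have p3 := mul_nonneg hCD' hN0
  linarith [k0, t, hδD, p1, p2, p3]

/-- **(GF3) FOR A NEARBY FRAME FIELD**: §3 ∘ §2 — (GF3) for `projG R (ker Q_{T₁})` with `(C_D, C_D′)`, unitary `R`, `T₁`, `T₂`, `‖T₁ − T₂‖ ≤ τ`, mismatch classes
(`2d(nw₁)² ≤ ½`, `0 ≤ w₂`), `4C_D·(4τ·revPC d n w₂)² ≤ 1` ⟹ (GF3) for `projG R (ker Q_{T₂})` with `(4C_D + 2, 2C_D′)`, same average `Q`. [folklore] -/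
theorem divControl_frames {R : Tor (fine n M) → Fin d → (E →L[ℂ] E)} (hU : ∀ x μ, R x μ ∈ unitary (E →L[ℂ] E))
    {T₁ T₂ : Tor (fine n M) → (E →L[ℂ] E)} (hT₁ : ∀ x, T₁ x ∈ unitary (E →L[ℂ] E)) (hT₂ : ∀ x, T₂ x ∈ unitary (E →L[ℂ] E))
    {τ : ℝ} (hτ : ∀ x, ‖T₁ x - T₂ x‖ ≤ τ) {w₁ w₂ : ℝ}
    (hw₁ : ∀ (x : Tor (fine n M)) (μ : Fin d), blockOf n M (x + unitVec (fine n M) μ) = blockOf n M x →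
      ‖R x μ * star (T₁ (x + unitVec (fine n M) μ)) * T₁ x - 1‖ ≤ w₁)
    (hsmall₁ : 2 * (d : ℝ) * ((n : ℝ) * w₁) ^ 2 ≤ 1 / 2) (hw₂0 : 0 ≤ w₂)
    (hw₂ : ∀ (x : Tor (fine n M)) (μ : Fin d), blockOf n M (x + unitVec (fine n M) μ) = blockOf n M x →
      ‖R x μ * star (T₂ (x + unitVec (fine n M) μ)) * T₂ x - 1‖ ≤ w₂)
    {Q : (Tor (fine n M) → Fin d → E) → (Tor M → Fin d → E)} {CD CD' : ℝ} (hCD : 0 ≤ CD) (hCD' : 0 ≤ CD')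
    (hGdiv₁ : ∀ W, ((n : ℝ) ^ d)⁻¹ * ((n : ℝ) ^ 2 * divSq (fine n M) R W)
      ≤ CD * ScV n M R (projG (fine n M) R (LinearMap.ker (avgOp n M T₁))) W + CD' * nsqV M (Q W))
    (hsmall : 4 * CD * (4 * τ * revPC d n w₂) ^ 2 ≤ 1) (W : Tor (fine n M) → Fin d → E) :
    ((n : ℝ) ^ d)⁻¹ * ((n : ℝ) ^ 2 * divSq (fine n M) R W)
      ≤ (4 * CD + 2) * ScV n M R (projG (fine n M) R (LinearMap.ker (avgOp n M T₂))) W + 2 * CD' * nsqV M (Q W) := by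
  have hτ0 : 0 ≤ τ := (norm_nonneg _).trans (hτ 0)
  have hδ0 : 0 ≤ 4 * τ * revPC d n w₂ := by have := revPC_nonneg (d := d) n w₂; positivity
  exact divControl_transfer n M R _ _ hCD hCD' hδ0 hGdiv₁ (sliceFrames_close n M hU hT₁ hT₂ hτ hw₁ hsmall₁ hw₂0 hw₂) hsmall W

end Summit.QuantumFields.BalabanUV.T4Continuum.SliceFrameGap

end
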